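import Summits.AtomisticToContinuum.HydrodynamicLimit.Theorems.CollisionIsometryCLTAdaptedWeightCLTTLColumnDepolarisationBalance
import Summits.AtomisticToContinuum.HydrodynamicLimit.Theorems.CollisionIsometryCLTAdaptedWeightCLTTLReductionMeasurable

/-!
# Column depolarisation, part M: measurability of the balance functionals in the window start
(helpers for the registered stub `stub_columnDepolarisation` of the line `contact-source-duhamel`,
crux `CollisionIsometryCLT.AdaptedWeightCLT`, stmt-AtomisticToContinuum-14868; `--supports`,
anchor `columnDepolarisation_measurable_anisF`)

The three inputs of the corrected stub (`IncoherentDiffuseAt`, `ManyCollisionsAt`,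
`OneStepNondegenerateAt`) and its conclusion `CDAlongAt` are local-Gibbs means (lower Lebesgue
integrals) of functionals of the window start `y = Φ_{t − Δℓ_N} z`; to add up the pathwise bound
`cd2 + cd3x ≤ 3/(c₀K) + C·osnErr + C·(carrPartF + pairPartF) + 84·𝟙_{few collisions}` under the
integral sign (`lintegral_add_left`) the two middle integrands must be MEASURABLE in `z`. This file
proves it, at regular diameter (`hsDiameter σ N < 1/2`), from the measurability of the fold data of
`…TLReductionFold/…TLReductionMeasurable` (`Reduction.measurable_tTransport`,
`Reduction.measurableSet_stepPair_eq`, `Reduction.measurable_of_countable_cases`):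
* for a FIXED number of fold steps, `cfam`, `cloud`, `anisT`, `dropT`, `pairTens` (case by case on
  the reflected pair) and hence `anisF`, `workF`, `carrPartF`, `pairPartF` are measurable in `y`;
* the number of fold steps of a window `steps σ N y Δ` is measurable in `y`
  (`Alexander.measurable_collisionCount`), so splitting it into its countably many values the
  integrands of `IncoherentDiffuseAt` (`measurable_incoherentIntegrand`) and of
  `OneStepNondegenerateAt` (`measurable_osnIntegrand`, a finite `⨆`, `Measurable.iSup`) are
  measurable in `y`, and in `z` after composition with the time-slice flow map
  (`HardSphereFlow.measurable_flow`).
No definition and no `Prop` is introduced.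
-/

namespace Summit.AtomisticToContinuum.HydrodynamicLimit.Theorems.ContactSourceDuhamel.TimeLocal
namespace ColumnDepolarisation

open scoped BigOperators Topology Classical MeasureTheory ENNReal InnerProductSpace
open Filter Set MeasureTheory
open Literature.Analysis.FluidPDE
open Literature.MathematicalPhysics.KineticTheory (hsDiameter hsDiameter_le)

noncomputable section

variable {σ : ℝ} {N : ℕ} {r : ℕ}

/-! ## Scalar functions of measurable tensor families -/

section Comp

variable {α : Type*} [MeasurableSpace α]

/-- `a ↦ ‖T a‖²` is measurable for measurable `T`. -/
theorem measurable_normSqT {T : α → Tens r} (hT : Measurable T) :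
    Measurable fun a => normSqT (T a) :=
  Finset.measurable_sum _ fun idx _ => ((measurable_pi_apply idx).comp hT).pow_const 2

/-- `a ↦ ⟨X a, Y a⟩` is measurable for measurable `X`, `Y`. -/
theorem measurable_pairT₂ {X Y : α → Tens r} (hX : Measurable X) (hY : Measurable Y) :
    Measurable fun a => pairT (X a) (Y a) :=
  Finset.measurable_sum _ fun idx _ =>
    ((measurable_pi_apply idx).comp hX).mul ((measurable_pi_apply idx).comp hY)

/-- `a ↦ tr (T a)` is measurable for measurable `T`. -/
theorem measurable_trT {T : α → Tens 2} (hT : Measurable T) : Measurable fun a => trT (T a) :=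
  Finset.measurable_sum _ fun b _ => (measurable_pi_apply (fun _ : Fin 2 => b)).comp hT

end Comp

/-! ## The cloud data for a fixed number of fold steps -/

section Fold

variable (hG : (Torus.geometry (Fin 3)).IsHardSphereRegular (hsDiameter σ N))
include hG

/-- `y ↦ cfam σ N y k a s` is measurable. -/
theorem measurable_cfam (k : Fin (N + 1)) (a : V3) (s : ℕ) :
    Measurable fun y : Cfg N => cfam σ N y k a s := by
  unfold cfam
  exact ((Reduction.measurable_tTransport (r := 2) hG 0 s).comp
    (measurable_id.prodMk measurable_const) :)

/-- `y ↦ cloud r σ N y s k a` is measurable. -/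
theorem measurable_cloud (r s : ℕ) (k : Fin (N + 1)) (a : V3) :
    Measurable fun y : Cfg N => cloud r σ N y s k a := by
  unfold cloud
  refine Finset.measurable_sum _ fun i _ => ?_
  exact ((measurable_pi_apply i).comp ((Reduction.measurable_tTransport (r := r) hG 0 s).comp
    (measurable_id.prodMk measurable_const)) :)

/-- `y ↦ anisT σ N y k a s` is measurable. -/
theorem measurable_anisT (k : Fin (N + 1)) (a : V3) (s : ℕ) :
    Measurable fun y : Cfg N => anisT σ N y k a s := by
  unfold anisT
  exact (measurable_cloud hG 2 s k a).sub measurable_const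

/-- `y ↦ dropT σ N y k a s` is measurable. -/
theorem measurable_dropT (k : Fin (N + 1)) (a : V3) (s : ℕ) :
    Measurable fun y : Cfg N => dropT σ N y k a s := by
  unfold dropT
  exact (measurable_cloud hG 2 s k a).sub (measurable_cloud hG 2 (s + 1) k a)

omit hG in
/-- `pairTens` by cases on the reflected pair (`Option.elim` form of its definition). -/
theorem pairTens_eq_elim (y : Cfg N) (k : Fin (N + 1)) (a : V3) (s : ℕ) :
    pairTens σ N y k a s =
      (stepPair σ N y s).elim 0 (fun pq => cfam σ N y k a s pq.1 + cfam σ N y k a s pq.2) := by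
  unfold pairTens
  cases stepPair σ N y s <;> rfl

/-- `y ↦ pairTens σ N y k a s` is measurable (case by case on the reflected pair). -/
theorem measurable_pairTens (k : Fin (N + 1)) (a : V3) (s : ℕ) :
    Measurable fun y : Cfg N => pairTens σ N y k a s := by
  simp only [pairTens_eq_elim]
  refine Reduction.measurable_of_countable_cases (Reduction.measurableSet_stepPair_eq hG s)
    (F := fun o y => o.elim (0 : Tens 2) (fun pq => cfam σ N y k a s pq.1 + cfam σ N y k a s pq.2))
    fun o => ?_
  cases o with
  | none => simpa only [Option.elim_none] using measurable_const
  | some pq =>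
    simp only [Option.elim_some]
    exact ((measurable_pi_apply pq.1).comp (measurable_cfam hG k a s)).add
      ((measurable_pi_apply pq.2).comp (measurable_cfam hG k a s))

/-! ## The balance functionals for fixed step counts -/

/-- `y ↦ anisF σ N y s` is measurable. -/
theorem measurable_anisF (s : ℕ) : Measurable fun y : Cfg N => anisF σ N y s := by
  unfold anisF
  exact (Finset.measurable_sum _ fun k _ => Finset.measurable_sum _ fun p _ =>
    Finset.measurable_sum _ fun q _ => measurable_normSqT (measurable_anisT hG k (dirV p q) s)).const_mul _

/-- `y ↦ workF σ N y m₁ m₂` is measurable. -/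
theorem measurable_workF (m₁ m₂ : ℕ) : Measurable fun y : Cfg N => workF σ N y m₁ m₂ := by
  unfold workF
  exact (Finset.measurable_sum _ fun k _ => Finset.measurable_sum _ fun p _ =>
    Finset.measurable_sum _ fun q _ => Finset.measurable_sum _ fun s _ =>
      measurable_pairT₂ (measurable_anisT hG k (dirV p q) s) (measurable_dropT hG k (dirV p q) s)).const_mul _

/-- `y ↦ carrPartF σ N y s` is measurable. -/
theorem measurable_carrPartF (s : ℕ) : Measurable fun y : Cfg N => carrPartF σ N y s := by
  unfold carrPartF
  refine (Finset.measurable_sum _ fun k _ => Measurable.add ?_ ?_).const_mul _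
  · exact Finset.measurable_sum _ fun p _ => Finset.measurable_sum _ fun q _ =>
      Finset.measurable_sum _ fun i _ =>
        (measurable_trT ((measurable_pi_apply i).comp (measurable_cfam hG k (dirV p q) s))).pow_const 2
  · exact Finset.measurable_sum _ fun p _ => Finset.measurable_sum _ fun i _ =>
      (measurable_trT ((measurable_pi_apply i).comp (measurable_cfam hG k (udir p) s))).pow_const 2

/-- `y ↦ pairPartF σ N y m₁ m₂` is measurable. -/
theorem measurable_pairPartF (m₁ m₂ : ℕ) : Measurable fun y : Cfg N => pairPartF σ N y m₁ m₂ := by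
  unfold pairPartF
  exact (Finset.measurable_sum _ fun k _ => Finset.measurable_sum _ fun p _ =>
    Finset.measurable_sum _ fun q _ => Finset.measurable_sum _ fun s _ =>
      (measurable_trT (measurable_pairTens hG k (dirV p q) s)).pow_const 2).const_mul _

/-! ## The number of fold steps of a window, and the two integrands -/

/-- `y ↦ steps σ N y Δ` is measurable (`Alexander.measurable_collisionCount`). -/
theorem measurable_steps (Δ : ℝ) : Measurable fun y : Cfg N => steps σ N y Δ := by
  unfold steps
  exact Alexander.measurable_collisionCount hG Reduction.gm Δ

/-- The level sets of the pair (steps of the half window, steps of the window) are measurable. -/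
theorem measurableSet_steps_pair_eq (Δ₁ Δ₂ : ℝ) (mm : ℕ × ℕ) :
    MeasurableSet {y : Cfg N | (steps σ N y Δ₂, steps σ N y Δ₁) = mm} := by
  have h : {y : Cfg N | (steps σ N y Δ₂, steps σ N y Δ₁) = mm} =
      {y | steps σ N y Δ₂ = mm.1} ∩ {y | steps σ N y Δ₁ = mm.2} := by
    ext y
    simp only [mem_setOf_eq, mem_inter_iff, Prod.ext_iff]
  rw [h]
  exact ((measurable_steps hG Δ₂) (measurableSet_singleton mm.1)).inter
    ((measurable_steps hG Δ₁) (measurableSet_singleton mm.2))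

/-- **The integrand of `IncoherentDiffuseAt` is measurable in the window start**: carrier
participation at the window's step count plus pair participation between the step counts of the
half window and of the window. -/
theorem measurable_incoherentIntegrand (Δ₁ Δ₂ : ℝ) :
    Measurable fun y : Cfg N =>
      carrPartF σ N y (steps σ N y Δ₁) + pairPartF σ N y (steps σ N y Δ₂) (steps σ N y Δ₁) :=
  Reduction.measurable_of_countable_cases (ι := ℕ × ℕ)
    (o := fun y : Cfg N => (steps σ N y Δ₂, steps σ N y Δ₁)) (measurableSet_steps_pair_eq hG Δ₁ Δ₂)
    (F := fun mm y => carrPartF σ N y mm.2 + pairPartF σ N y mm.1 mm.2)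
    fun mm => (measurable_carrPartF hG mm.2).add (measurable_pairPartF hG mm.1 mm.2)

/-- **The integrand of `OneStepNondegenerateAt` is measurable in the window start**: the finite
supremum over the final stretches of at most `K(N+1)` fold steps of the window of
`c₀ (N+1)⁻¹ Σ_s anisF s − workF`. -/
theorem measurable_osnIntegrand (c₀ : ℝ) (K : ℕ) (Δ : ℝ) :
    Measurable fun y : Cfg N =>
      ⨆ j : Fin (K * (N + 1) + 1),
        (c₀ * ((N + 1 : ℕ) : ℝ)⁻¹ * ∑ s ∈ Finset.Ico (steps σ N y Δ - (j : ℕ)) (steps σ N y Δ),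
            anisF σ N y s -
          workF σ N y (steps σ N y Δ - (j : ℕ)) (steps σ N y Δ)) := by
  refine Measurable.iSup fun j => ?_
  exact Reduction.measurable_of_countable_cases (o := fun y : Cfg N => steps σ N y Δ)
    (fun m => (measurable_steps hG Δ) (measurableSet_singleton m))
    (F := fun m y => c₀ * ((N + 1 : ℕ) : ℝ)⁻¹ * ∑ s ∈ Finset.Ico (m - (j : ℕ)) m, anisF σ N y s -
      workF σ N y (m - (j : ℕ)) m)
    fun m => ((Finset.measurable_sum _ fun s _ => measurable_anisF hG s).const_mul _).sub
      (measurable_workF hG _ _)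

end Fold

/-! ## Along the flow: measurability in the datum `z` -/

/-- The integrand of `IncoherentDiffuseAt`, read at `y = Φ_τ z`, is a measurable function of `z`
(regular diameter). -/
theorem measurable_incoherentIntegrand_flow
    (hG : (Torus.geometry (Fin 3)).IsHardSphereRegular (hsDiameter σ N)) (Φ : Flow σ N)
    (τ Δ₁ Δ₂ : ℝ) :
    Measurable fun z : Cfg N => ENNReal.ofReal
      (carrPartF σ N (Φ.flow τ z) (steps σ N (Φ.flow τ z) Δ₁) +
        pairPartF σ N (Φ.flow τ z) (steps σ N (Φ.flow τ z) Δ₂) (steps σ N (Φ.flow τ z) Δ₁)) :=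
  ENNReal.measurable_ofReal.comp
    ((measurable_incoherentIntegrand hG Δ₁ Δ₂).comp (Φ.measurable_flow τ))

/-- The integrand of `OneStepNondegenerateAt`, read at `y = Φ_τ z`, is a measurable function of
`z` (regular diameter). -/
theorem measurable_osnIntegrand_flow
    (hG : (Torus.geometry (Fin 3)).IsHardSphereRegular (hsDiameter σ N)) (Φ : Flow σ N)
    (τ c₀ : ℝ) (K : ℕ) (Δ : ℝ) :
    Measurable fun z : Cfg N => ENNReal.ofReal
      (⨆ j : Fin (K * (N + 1) + 1),
        (c₀ * ((N + 1 : ℕ) : ℝ)⁻¹ *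
            ∑ s ∈ Finset.Ico (steps σ N (Φ.flow τ z) Δ - (j : ℕ)) (steps σ N (Φ.flow τ z) Δ),
              anisF σ N (Φ.flow τ z) s -
          workF σ N (Φ.flow τ z) (steps σ N (Φ.flow τ z) Δ - (j : ℕ)) (steps σ N (Φ.flow τ z) Δ))) :=
  ENNReal.measurable_ofReal.comp ((measurable_osnIntegrand hG c₀ K Δ).comp (Φ.measurable_flow τ))

/-! ## Registered anchor -/

/-- `y ↦ anisF σ N y s` is measurable at regular diameter (registered anchor of this helper file). -/
theorem columnDepolarisation_measurable_anisF : ∀ (σ : ℝ) (N s : ℕ),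
    (Literature.Analysis.FluidPDE.Torus.geometry (Fin 3)).IsHardSphereRegular
      (Literature.MathematicalPhysics.KineticTheory.hsDiameter σ N) →
        Measurable fun y : Cfg N => anisF σ N y s :=
  fun _ _ s hG => measurable_anisF hG s

end

end ColumnDepolarisation
end Summit.AtomisticToContinuum.HydrodynamicLimit.Theorems.ContactSourceDuhamel.TimeLocal
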